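import Mathlib.RingTheory.Ideal.Operations
import Mathlib.RingTheory.Ideal.Maps
import HarnessLib

/-!
# [OURS · L1 W4.5(b) · EL♮] COMPANION ISOTROPY: a companion surface through a point `z` of the avatar forces the lift direction at `z`
# to be ISOTROPIC for the transversal quadratic form — ring form of the load-bearing step of the COMPANIONS door of kill test #50
# (crux `EquisingularLiftNat` = stmt-ResolutionOfSingularities-20038; PARENT ≥ 4 band / kill test #50 K5-BMY)

HONEST FRAMING. OURS (cell res-hironaka, crux chain w45b, slot W4.5(b)); NOT a statement of any manuscript; replaces the role of NOTHING
in the manuscript; AI-written, AI review is weaker than expert review. Helper `--supports stmt-ResolutionOfSingularities-20038 --as helper`.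
Object named by res-L1-w45b-plan-1 (ACK 18:52:21Z: «COMPANIONS door … one kernel brick for the load-bearing ring step»); memo
`L/res-L1-w45b-lead-1/COMPANIONS.md` (res-L1-w45b-lead-1 gen 7, ULT-STATUS v7) §1.

THE SITUATION (COMPANIONS.md §1). At a closed point `z` of the avatar `S ⊂ Y ⊂ P_s`, let `B = 𝒪_{P_s,z}` (regular local, `𝔪 = 𝔪_z`), `P = I_S`,
`F` the local equation of the hypersurface `Y` (`F ∈ P²`: `Y` is singular along `S`). A COMPANION NOSE is a regular `O`-flat centre `C`
with `C_s = S ∪ R` near `z`; its special fibre has embedding dimension `3` at `z`, so it lies in a smooth `3`-fold germ `M = V(J) ⊃ S`, in which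
`S = V(t)` is a divisor (`P = J + (t)`), and E1 puts the companion `R` inside `M ∩ Y`: `R ↔` a prime `Q ⊇ J + (F)` with `t ∉ Q` (`R ≠ S`).
Writing `F ≡ t²·w (mod J)` (possible since `P² ⊆ J + (t²)`, `sq_sup_span_singleton_le`), the class of `w` in `B/𝔪 = k(z)` is the value
`q_z(v)` of the transversal quadratic form of `Y` on the normal direction `v = T_z M / T_z S` of the shadow `M`.

THE THEOREM (`mem_sup_span_sq_mul_of_companion`): `J ≤ Q`, `F ∈ Q`, `t ∉ Q`, `Q` prime, `Q ≤ 𝔪`, `F ∈ J + (t²)` ⟹ `F ∈ J + (t²)·𝔪` —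
i.e. `q_z(v) = 0`: **the lift direction is ISOTROPIC at every point of the companion curve** (and, contrapositively,
`forall_mem_of_not_mem` : if `F ∉ J + (t²)·𝔪` — anisotropic direction — every prime over `J + (F)` contains `t`: `M ∩ Y = S` set-theoretically,
no companion passes through `z` inside `M`). Over the generic point of `S` every direction is anisotropic (ANISO), so companions meet the
avatar only along CURVES `D`, along which the direction field `N_{S/C} ≅ 𝒪_S(−D′) ↪ N_S` is a section of the conic bundle `{q = 0}|_D`
(COMPANIONS.md §1–§2; Tsen supplies rational sections over curves, the Brauer class of the conic forbids them over `S`).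

References: [folklore] (prime avoidance of `t`); memo COMPANIONS.md; res-L1-w45b-lead-1 M-CENTRES.md §2 (the curve case, n = 3).
-/

set_option linter.dupNamespace false -- mandated namespace `Summit.<Summit>.<Problem>` of this single-conjunct summit

universe u

namespace Summit.ResolutionOfSingularities.ResolutionOfSingularities.Cruxes.EquisingularLiftNat.Sections

namespace CompanionIsotropy

variable {B : Type u} [CommRing B]

/-- `(J + (t))² ⊆ J + (t²)`: the square of the ideal of the divisor `S = V(t)` of the germ `M = V(J)` lies in `J + (t²)` — so the equation
`F ∈ I_S²` of a hypersurface singular along `S` is `≡ t²·w (mod J)`. [folklore] -/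
theorem sq_sup_span_singleton_le (J : Ideal B) (t : B) :
    (J ⊔ Ideal.span {t}) ^ 2 ≤ J ⊔ Ideal.span {t ^ 2} := by
  have htt : Ideal.span {t} * Ideal.span {t} = Ideal.span {t ^ 2} := by
    rw [Ideal.span_singleton_mul_span_singleton, pow_two]
  rw [pow_two, Ideal.sup_mul, Ideal.mul_sup, Ideal.mul_sup, htt]
  refine sup_le (sup_le ?_ ?_) (sup_le ?_ le_sup_right)
  · exact le_trans Ideal.mul_le_right le_sup_left
  · exact le_trans Ideal.mul_le_right le_sup_left
  · exact le_trans Ideal.mul_le_left le_sup_left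

/-- **COMPANION ISOTROPY (ring form).** If a prime `Q` (the companion `R`) contains `J` (the shadow `M`) and `F` (the hypersurface `Y`) but
not `t` (`R ≠ S`), and `F ∈ J + (t²)`, then `F ∈ J + (t²)·𝔐` for every ideal `𝔐 ⊇ Q` (take `𝔐 = 𝔪_z`): writing `F = j + w t²`, one has
`w t² ∈ Q`, `t² ∉ Q`, so `w ∈ Q`. Geometrically: the value `q_z(v)` of the transversal form on the normal direction of `M` vanishes —
the lift direction is isotropic at every point of the companion curve. OURS. [folklore] -/
theorem mem_sup_span_sq_mul_of_companion {J Q 𝔐 : Ideal B} {t F : B} [hQ : Q.IsPrime] (hJQ : J ≤ Q) (hFQ : F ∈ Q) (htQ : t ∉ Q)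
    (hQM : Q ≤ 𝔐) (hF : F ∈ J ⊔ Ideal.span {t ^ 2}) : F ∈ J ⊔ Ideal.span {t ^ 2} * 𝔐 := by
  obtain ⟨j, hj, z, hz, hjz⟩ := Submodule.mem_sup.mp hF
  obtain ⟨w, rfl⟩ := Ideal.mem_span_singleton'.mp hz
  have hwt : w * t ^ 2 ∈ Q := by
    have : w * t ^ 2 = F - j := by rw [← hjz]; ring
    rw [this]
    exact Q.sub_mem hFQ (hJQ hj)
  have ht2 : t ^ 2 ∉ Q := fun h => htQ (hQ.mem_of_pow_mem 2 h)
  have hw : w ∈ Q := (hQ.mem_or_mem hwt).resolve_right ht2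
  rw [← hjz]
  refine Ideal.add_mem _ (Ideal.mem_sup_left hj) (Ideal.mem_sup_right ?_)
  rw [mul_comm (Ideal.span {t ^ 2}) 𝔐]
  exact Ideal.mul_mem_mul (hQM hw) (Ideal.mem_span_singleton_self _)

/-- **Contrapositive: an ANISOTROPIC direction admits no companion.** If `F ∈ J + (t²)` but `F ∉ J + (t²)·𝔐` (the coefficient `w` of `t²`
is a unit — `q_z(v) ≠ 0`), then every prime `Q` with `J ≤ Q ≤ 𝔐` and `F ∈ Q` contains `t`: inside the shadow `M`, the hypersurface `Y`
meets only `S` — no companion component through `z`. OURS. [folklore] -/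
theorem mem_of_not_mem_sup_span_sq_mul {J Q 𝔐 : Ideal B} {t F : B} [Q.IsPrime] (hJQ : J ≤ Q) (hFQ : F ∈ Q) (hQM : Q ≤ 𝔐)
    (hF : F ∈ J ⊔ Ideal.span {t ^ 2}) (hnot : F ∉ J ⊔ Ideal.span {t ^ 2} * 𝔐) : t ∈ Q := by
  by_contra htQ
  exact hnot (mem_sup_span_sq_mul_of_companion hJQ hFQ htQ hQM hF)

/-- The same packaged from `F ∈ P²` with `P = J + (t)` (the ideal of the avatar `S`: `Y` singular along `S`). OURS. [folklore] -/
theorem mem_sup_span_sq_mul_of_companion' {J Q 𝔐 : Ideal B} {t F : B} [Q.IsPrime] (hJQ : J ≤ Q) (hFQ : F ∈ Q) (htQ : t ∉ Q)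
    (hQM : Q ≤ 𝔐) (hF : F ∈ (J ⊔ Ideal.span {t}) ^ 2) : F ∈ J ⊔ Ideal.span {t ^ 2} * 𝔐 :=
  mem_sup_span_sq_mul_of_companion hJQ hFQ htQ hQM (sq_sup_span_singleton_le J t hF)

end CompanionIsotropy

end Summit.ResolutionOfSingularities.ResolutionOfSingularities.Cruxes.EquisingularLiftNat.Sections
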